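import Summits.Ventures.HodgeRepro2.T5CircleWeights

/-!
# The infinitesimal `SO(2)`-weight: `−i d/dθ` acts on the `n`-th `K`-type by `n`

Tier-5 support (N4.3 = (R3), step (P2′): «the SO(2)-weights»; route/T5-SUPPORT-p1.md §S4.13,
§S4.16 row 4).  For a representation `ρ` of the circle group on `V` and a weight vector `v` of
weight `n` (`ρ z v = zⁿ • v`, i.e. `v ∈ weightSpace ρ (zpowChar n)`):

* `apply_exp_weightVector`: `ρ (k(θ)) v = e^{inθ} • v` along the one-parameter group
  `k(θ) = Circle.exp θ`;
* `hasDerivAt_apply_exp_weightVector`: `θ ↦ ρ (k(θ)) v` is differentiable with derivative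
  `(i n) e^{inθ} • v`, and at `θ = 0` the derivative is `(i n) • v`
  (`hasDerivAt_apply_exp_weightVector_zero`): the infinitesimal generator of `SO(2)` acts on the
  `n`-th `K`-type by `i n`, so `−i d/dθ|₀` acts by `n` (`neg_I_smul_deriv_eq`).

This is the GROUP-level identification of the `SO(2)`-weight `n` with the eigenvalue of the
infinitesimal generator, in the finite-dimensional setting of this lane; with
`T5RotationGenerator` (`k′(0) = W`) and `T5Sl2Standard.cayley_h₀` (`h₀ C = C (−I • W)`) it is the
kernel form of the sentence «the `h₀`-eigenvalue is the `SO(2)`-weight» — for `π₃⁺` itself the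
statement stays printed ([C]).

Blind lane: Mathlib + own prefix; no sorry; axioms ⊆ {propext, Classical.choice, Quot.sound}.
-/

namespace Summit.Ventures.HodgeRepro2.T5CircleWeightDerivative

open Summit.Ventures.HodgeRepro2.T5WeightSpaces Summit.Ventures.HodgeRepro2.T5CircleWeights

variable {V : Type*} [NormedAddCommGroup V] [InnerProductSpace ℂ V]
variable (ρ : Circle →* V →L[ℂ] V)

/-- `(Circle.exp θ : ℂ)ⁿ = e^{inθ}`. -/
lemma coe_circleExp_zpow (n : ℤ) (θ : ℝ) :
    ((Circle.exp θ : Circle) : ℂ) ^ n = Complex.exp (n * (θ * Complex.I)) := by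
  rw [Circle.coe_exp, ← Complex.exp_int_mul]

/-- Along the one-parameter group `k(θ)`, a weight vector of weight `n` transforms by `e^{inθ}`. -/
lemma apply_exp_weightVector {n : ℤ} {v : V} (hv : v ∈ weightSpace ρ (zpowChar n)) (θ : ℝ) :
    ρ (Circle.exp θ) v = Complex.exp (n * (θ * Complex.I)) • v := by
  rw [(mem_weightSpace ρ (zpowChar n)).mp hv, coe_zpowChar_apply, coe_circleExp_zpow]

/-- `θ ↦ e^{inθ}` has derivative `(i n) e^{inθ}`. -/
lemma hasDerivAt_exp_int_mul (n : ℤ) (θ₀ : ℝ) :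
    HasDerivAt (fun θ : ℝ => Complex.exp (n * (θ * Complex.I)))
      (n * Complex.I * Complex.exp (n * (θ₀ * Complex.I))) θ₀ := by
  have h1 : HasDerivAt (fun θ : ℝ => ((θ : ℂ))) 1 θ₀ := Complex.ofRealCLM.hasDerivAt
  have h2 : HasDerivAt (fun θ : ℝ => (n : ℂ) * ((θ : ℂ) * Complex.I)) (n * Complex.I) θ₀ := by
    have := (h1.mul_const Complex.I).const_mul (n : ℂ)
    simpa using this
  have := h2.cexp
  simpa [mul_comm] using this

/-- **The infinitesimal weight**: `θ ↦ ρ (k(θ)) v` has derivative `(i n) e^{inθ} • v` on a weight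
vector of weight `n`. -/
theorem hasDerivAt_apply_exp_weightVector {n : ℤ} {v : V} (hv : v ∈ weightSpace ρ (zpowChar n))
    (θ₀ : ℝ) :
    HasDerivAt (fun θ : ℝ => ρ (Circle.exp θ) v)
      ((n * Complex.I * Complex.exp (n * (θ₀ * Complex.I))) • v) θ₀ := by
  have := (hasDerivAt_exp_int_mul n θ₀).smul_const v
  refine this.congr_of_eventuallyEq (Filter.Eventually.of_forall fun θ => ?_)
  exact apply_exp_weightVector ρ hv θ

/-- At `θ = 0`: the derivative is `(i n) • v`. -/
theorem hasDerivAt_apply_exp_weightVector_zero {n : ℤ} {v : V}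
    (hv : v ∈ weightSpace ρ (zpowChar n)) :
    HasDerivAt (fun θ : ℝ => ρ (Circle.exp θ) v) ((n * Complex.I) • v) 0 := by
  have := hasDerivAt_apply_exp_weightVector ρ hv 0
  simpa using this

/-- `−i · d/dθ|₀ (ρ (k(θ)) v) = n • v`: the infinitesimal generator `−i d/dθ` has eigenvalue `n`
on the `n`-th `K`-type. -/
theorem neg_I_smul_deriv_eq {n : ℤ} {v : V} (hv : v ∈ weightSpace ρ (zpowChar n)) :
    (-Complex.I) • deriv (fun θ : ℝ => ρ (Circle.exp θ) v) 0 = (n : ℂ) • v := by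
  rw [(hasDerivAt_apply_exp_weightVector_zero ρ hv).deriv, smul_smul]
  congr 1
  ring_nf
  rw [Complex.I_sq]
  ring

end Summit.Ventures.HodgeRepro2.T5CircleWeightDerivative
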